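/-
Copyright (c) 2026 the pub-hodgecm-mathlib formalisation cell (harness21).  Prover seat hodgecm-mathlib-LH7-p05 (g0), req620 Track A «(D-RAM) FOUR-FRAME» squad, helper lane on
h413 = stmt-HodgeConjecture-24833 (count-neutral).  β-BOARD v1 row R7 «GLUE CLASSES» (sub-dealer LH4-p05 (g8) ✋ LEDGER #1; SIG-R7-GlueClasses v1 c4b08d36).  2026-09-04.
-/
import Summits.HodgeConjecture.HodgeConjecture.Theorems.F0P3cDyRamLabelledOddPureStrataG1   -- ★ p860827 (LH4-p11 (g8)): the G₁ cell row; brings ★ `stratum_G1_eq`, ★ G1 reads, ★ DEFS (labelled odd count, mc∕m*)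
import HarnessLib

/-!
# Crux `H413`, line LH4 «(D-RAM) FOUR-FRAME» — (β) Stage B, β-BOARD row R7: THE GLUE CLASSES of the glued stratum `G₁ = (2ρ, 2ρ+s, 2ρ+s)` OFF THE TUBE READ —
# `Σᶠ_{M ∈ stratum G₁, clean shell} labelledOddCount σ ϖ 0 i Λ M ∕ [𝒰 : N(S̃′(M))] = 0` wherever the clean-shell CUT of the stratum is EMPTY

Cell `hodgecm-mathlib` (D-0151), FLOOR 0, crux item H413 = `stmt-HodgeConjecture-24833`, route `HCCMUnconditional`; squad F0∕P3c∕LH4 (β-table fan, sub-dealer LH4-p05 (g8)).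
THEOREMS ONLY (no `def`, no instance, no notation, no `sorry`, default heartbeats); ★-only imports; lane `--supports stmt-HodgeConjecture-24833 --as helper` (count-neutral);
pays NO row, states NO law.  Consumer: F0P3a-p01 (g37)'s (T2) trunk `hbox_of_oddBoxSum`, binder `hRest` (the rest-sum row of ★-pending (T1) v1 `OddLabelledBoxSum`): the glued
axis vectors that are NOT capped tube classes.  Binders = ★ p860827's, VERBATIM (general `N₀` with `mcOfRecord d ≤ N₀`).

THE MATHEMATICS (SIG-R7-GlueClasses v1 §1).  A member of the stratum is the glued normal form `latt (1 0 0; x ϖ^ρ 0; xζ+y″ ϖ^ρζ ϖ^{2ρ+s})`, `|x| = |ζ| = 1`, `|y″| = |ϖ|^s`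
(★ `stratum_G1_eq`); the tokens of `X = diag(α−1, β−1, 0)` and `X²` on it are read by ★ `latticeInLevel_diagonal_latt_G1_iff` (mixed term `xζ(e₂−e₁) + (e₂−e₀)y″` explicit).
* §1 OFF THE GLUE FOOT (`n₁ ≠ n₂ + s`) the read is constant (★ `…_of_ne`); stability gives `2ρ + s ≤ n₁`, `2ρ ≤ n₂` (★ `depths_of_mapGL_latt_hnf_glued_eq`), so every member sits in
  level `ℓ₀` and leaves level `ℓ₀ + 1` only on one of the two exact reads `2ρ + s + ℓ₀ = n₁` (the capped tube ∕ cell row) or `2ρ + ℓ₀ = n₂` (the κ-classes, row R6): off both,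
  the cut is EMPTY — `finsum_stratum_G1_shell_labelledOdd_div_relIndex_eq_zero_of_offFoot`; and in the GLUE REGION `min n₂ n₃ < 2ρ + ℓ₀` (tube read or not) the level-`ℓ₀` token
  fails or the stratum is empty — `…_eq_zero_of_offFoot_glue` (F0P3a-p01 (g37)'s coverage cells C2b ∪ C5-off-foot in one head).
* §2 ON THE FOOT (`n₁ = n₂ + s`; then `n₃ = n₂ = m` by the isosceles read): in the tube range `2ρ + ℓ₀ + 2 ≤ n₂` every member sits inside level `ℓ₀ + 1` (both terms of the mixed
  inequality have valuation `n₁ ≥ ℓ₀ + 1 + 2ρ + s`), and for the TOP classes `2·n₂ < 2ρ + mc` the square token at `mc = mcOfRecord d` FAILS (the mixed term of the read at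
  `e = ((α−1)², (β−1)², 0)` has valuation exactly `2n₂ + s < mc + 2ρ + s`): the cut is EMPTY — `…_eq_zero_of_foot_tube`, `…_eq_zero_of_foot_top`.
The remaining foot window `n₂ ≤ 2ρ + ℓ₀`, `2ρ + mc ≤ 2·n₂` (the on-foot κ-class and the clean glue classes, where the cut is non-empty and the value vanishes by sign cancellation) is
the sequel head (SIG §3); the off-foot κ-classes `2ρ + ℓ₀ = n₂` are row R6 (LH4-p13) and the in-cell zero is ★ p860827 — neither is restated here.
HONEST LABEL: count-neutral; R7 (foot window) ∕ hRest ∕ (β-BAL) ∕ (β) ∕ T₊ OPEN; `HC_CM` is proved only modulo the 7 printed citations (2 remaining named inputs: hLiu418 =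
`stmt-HodgeConjecture-24832`, h413 = `stmt-HodgeConjecture-24833`) until rung 0 closes.
References: [Kottwitz1986BaseChangeUnits] §1 pp. 240–241 · [Rogawski1990] §4.9 Prop. 4.9.1 (a)(b) p. 55, §4.10 p. 58 · [Serre1980Trees] Ch. II §1.1 · [Jacobowitz1962] §4, §7.
-/

set_option autoImplicit false

noncomputable section

namespace Summit.HodgeConjecture.HodgeConjecture.Cruxes.H413.F0P3cDyRamLabelledOddGlueClasses

open Matrix WithZero
open Literature.NumberTheory.Automorphic Literature.NumberTheory.Automorphic.HermitianLattice
open Literature.NumberTheory.Automorphic.UnitaryLatticeTree Literature.NumberTheory.Automorphic.UnitaryThreeFourFrame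
open Literature.NumberTheory.LocalFields Literature.NumberTheory.LocalFields.WildQuadraticDatum
open Summit.HodgeConjecture.HodgeConjecture.Cruxes.H413.F0P3cDyRamFourFramePieces
open Summit.HodgeConjecture.HodgeConjecture.Cruxes.H413.F0P3cDyRamFourFrameCensusDefs
open Summit.HodgeConjecture.HodgeConjecture.Cruxes.H413.F0P3cDyRamStageOneBDefs (mcOfRecord)
open Summit.HodgeConjecture.HodgeConjecture.Cruxes.H413.F0P3cDyRamDiagonalTorusDefs
open Summit.HodgeConjecture.HodgeConjecture.Cruxes.H413.F0P3cDyRamDiagonalStrataDefs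
open Summit.HodgeConjecture.HodgeConjecture.Cruxes.H413.F0P3cDyRamLabelledOddCountDefs
open Summit.HodgeConjecture.HodgeConjecture.Cruxes.H413.F0P3cDyRamDiagonalGluedStratum (stratum_G1_eq two_dvd_of_mem_stratum_G1)
open Summit.HodgeConjecture.HodgeConjecture.Cruxes.H413.F0P3cDyRamDiagonalGluedStability (depths_of_mapGL_latt_hnf_glued_eq)
open Summit.HodgeConjecture.HodgeConjecture.Cruxes.H413.F0P3cDyRamLabelledGluedStratumRead (latticeInLevel_diagonal_latt_G1_iff latticeInLevel_diagonal_latt_G1_iff_of_ne)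
open Summit.HodgeConjecture.HodgeConjecture.Cruxes.H413.F0P3cDyRamLabelledKappaSplitStrata (v_le_pow_iff_of_eq)
open Summit.HodgeConjecture.HodgeConjecture.Cruxes.H413.F0P3cDyRamStableCountTypeZero (v_diag_eq_one)
open scoped Valued WithZero Matrix MatrixGroups

variable {K : Type} [Field K] [Valued K ℤᵐ⁰] {σ : K →+* K} {ϖ : K} {d t : ℕ} {α β : K} {N₀ n₁ n₂ n₃ : ℕ}

/-! ## §1  Off the glue foot, off both exact reads: the clean-shell cut of `G₁` is empty -/

/-- **OFF THE FOOT, OFF BOTH EXACT READS, NO MEMBER OF `G₁ = (2ρ, 2ρ+s, 2ρ+s)` IS ON THE CLEAN SHELL** (token-free): if `n₁ ≠ n₂ + s`, `2ρ + s + ℓ₀ ≠ n₁` and `2ρ + ℓ₀ ≠ n₂`,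
then for every member the conjunction «level `ℓ₀` ∧ not level `ℓ₀+1`» of `X = diag(α−1, β−1, 0)` fails (★ constant read + ★ stability depths `2ρ + s ≤ n₁`, `2ρ ≤ n₂`, isosceles
`min n₁ n₂ ≤ n₃`). [cite: Kottwitz1986BaseChangeUnits, §1 pp. 240–241] [cite: Rogawski1990, §4.9 Prop. 4.9.1 (a) p. 55] -/
theorem not_shell_of_mem_stratum_G1_offFoot (hD : IsRamifiedQuadraticDatum σ ϖ d t) (h2d : 2 ≤ d)
    (hE : IsElementDatum σ ϖ N₀ α β n₁ n₂ n₃) (hmc : mcOfRecord d ≤ N₀)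
    (T : GL (Fin 3) K) (hT : (T : Matrix (Fin 3) (Fin 3) K) = Matrix.diagonal ![α, β, 1]) (ρ s : ℕ) (hρ : 1 ≤ ρ) (hs : 1 ≤ s)
    (hfoot : n₁ ≠ n₂ + s) (hread : 2 * ρ + s + d % 2 ≠ n₁) (hκ : 2 * ρ + d % 2 ≠ n₂) :
    ∀ M ∈ stratum σ ϖ T ![2 * ρ, 2 * ρ + s, 2 * ρ + s],
      ¬ (LatticeInLevel ϖ (d % 2) (Matrix.diagonal ![α - 1, β - 1, 0]) M ∧ ¬ LatticeInLevel ϖ (d % 2 + 1) (Matrix.diagonal ![α - 1, β - 1, 0]) M ∧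
          LatticeInLevel ϖ (mcOfRecord d) (Matrix.diagonal ![(α - 1) * (α - 1), (β - 1) * (β - 1), 0]) M) := by
  classical
  have hD' := hD
  obtain ⟨hσ, hvσ, hϖ, hfix, -, -, -⟩ := hD'
  have hϖ0 : ϖ ≠ 0 := fun h0 => by rw [h0, map_zero] at hϖ; exact WithZero.coe_ne_zero hϖ.symm
  have hϖlt : Valued.v ϖ < 1 := by rw [hϖ, ← WithZero.exp_zero, WithZero.exp_lt_exp]; norm_num
  have hα : Valued.v (α - 1) = Valued.v ϖ ^ n₂ := hE.2.2.2.2.2.2.1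
  have hβ : Valued.v (β - 1) = Valued.v ϖ ^ n₁ := hE.2.2.2.2.2.1
  have hγ : Valued.v (α - β) = Valued.v ϖ ^ n₃ := hE.2.2.2.2.2.2.2.1
  have hn₁ : N₀ ≤ n₁ := hE.2.2.2.2.2.2.2.2.1
  have hn₂ : N₀ ≤ n₂ := hE.2.2.2.2.2.2.2.2.2.1
  have hn₃ : N₀ ≤ n₃ := hE.2.2.2.2.2.2.2.2.2.2
  have hmcv : mcOfRecord d = 2 * ((d % 2 + 2 * d - 1 + d) / 2) := rfl
  rw [hmcv] at hmc
  have hγ' : Valued.v (β - 1 - (α - 1)) = Valued.v ϖ ^ n₃ := by rw [show β - 1 - (α - 1) = -(α - β) by ring, Valuation.map_neg, hγ]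
  have hpw : ∀ a b : ℕ, Valued.v ϖ ^ a ≤ Valued.v ϖ ^ b ↔ b ≤ a := fun a b => by
    rw [v_varpi_pow hϖ, v_varpi_pow hϖ, WithZero.exp_le_exp]; omega
  have hv0 : ∀ ℓ : ℕ, Valued.v (0 : K) ≤ Valued.v ϖ ^ ℓ := fun ℓ => by rw [map_zero]; exact zero_le
  have hsv := v_diag_eq_one hvσ hE
  have hαv : Valued.v α = 1 := by simpa using hsv 0
  have hβv : Valued.v β = 1 := by simpa using hsv 1
  -- isosceles: `min n₁ n₂ ≤ n₃`
  have hn₃min : min n₁ n₂ ≤ n₃ := by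
    have h := Valuation.map_sub Valued.v (β - 1) (α - 1)
    rw [hγ', hβ, hα, le_max_iff, hpw, hpw] at h
    omega
  intro M hM
  rw [stratum_G1_eq hvσ hfix hϖ T hρ hs] at hM
  obtain ⟨x, ζ, y'', hx, hζ, hy, rfl, hTM, -⟩ := hM
  have hdet : (!![1, 0, 0; x, ϖ ^ ρ, 0; x * ζ + y'', ϖ ^ ρ * ζ, ϖ ^ (2 * ρ + s)] : Matrix (Fin 3) (Fin 3) K).det ≠ 0 := by
    rw [Matrix.det_fin_three]; simp [hϖ0]
  -- stability depths off the foot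
  obtain ⟨h1, h2⟩ := depths_of_mapGL_latt_hnf_glued_eq hϖ0 hϖlt hαv hβv T hT hβ hα ρ s hfoot hx hζ hy
    (Matrix.GeneralLinearGroup.mkOfDetNeZero _ hdet) rfl hTM
  have hne : Valued.v ((![α - 1, β - 1, 0] : Fin 3 → K) 2 - (![α - 1, β - 1, 0] : Fin 3 → K) 1) ≠
      Valued.v ((![α - 1, β - 1, 0] : Fin 3 → K) 2 - (![α - 1, β - 1, 0] : Fin 3 → K) 0) * Valued.v ϖ ^ s := by
    simp only [Matrix.cons_val_zero, Matrix.cons_val_one, Matrix.cons_val_two, Matrix.tail_cons, Matrix.head_cons, zero_sub, Valuation.map_neg, hα, hβ, ← pow_add]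
    rw [v_varpi_pow hϖ, v_varpi_pow hϖ, Ne, WithZero.exp_inj]; omega
  have r2 := v_le_pow_iff_of_eq hD hβ
  have r3 := v_le_pow_iff_of_eq hD hγ'
  rw [latticeInLevel_diagonal_latt_G1_iff_of_ne hϖ0 (d % 2) ρ s _ hx hζ hy hne, latticeInLevel_diagonal_latt_G1_iff_of_ne hϖ0 (d % 2 + 1) ρ s _ hx hζ hy hne]
  simp only [Matrix.cons_val_zero, Matrix.cons_val_one, Matrix.cons_val_two, Matrix.tail_cons, Matrix.head_cons, zero_sub, Valuation.map_neg, hv0, and_true, r2, r3, hα, ← pow_add, hpw]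
  rintro ⟨⟨⟨-, -⟩, hl3, hl4, hl5, hl6⟩, h2', -⟩
  apply h2'
  refine ⟨⟨by omega, by omega⟩, by omega, by omega, by omega, by omega⟩

/-- **R7, OFF THE FOOT: `G₁` OFF BOTH EXACT READS CARRIES LABELLED ODD VALUE `0`** in every slot (empty cut; odd `s` included).  Binders ★ p860827 verbatim; the κ-classes
`2ρ + ℓ₀ = n₂` (row R6) and the tube read `2ρ + s + ℓ₀ = n₁` (cell row ★ p860827 ∕ rows R3) are excluded by hypothesis, NOT restated.
[cite: Kottwitz1986BaseChangeUnits, §1 pp. 240–241] [cite: Rogawski1990, §4.9 Prop. 4.9.1 (a)(b) p. 55] -/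
theorem finsum_stratum_G1_shell_labelledOdd_div_relIndex_eq_zero_of_offFoot (hD : IsRamifiedQuadraticDatum σ ϖ d t) (h2d : 2 ≤ d)
    (hE : IsElementDatum σ ϖ N₀ α β n₁ n₂ n₃) (hmc : mcOfRecord d ≤ N₀)
    (T : GL (Fin 3) K) (hT : (T : Matrix (Fin 3) (Fin 3) K) = Matrix.diagonal ![α, β, 1]) (ρ s : ℕ) (hρ : 1 ≤ ρ) (hs : 1 ≤ s)
    (hfoot : n₁ ≠ n₂ + s) (hread : 2 * ρ + s + d % 2 ≠ n₁) (hκ : 2 * ρ + d % 2 ≠ n₂) (i : Fin 3) :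
    ∑ᶠ M ∈ {M : Submodule 𝒪[K] (Fin 3 → K) | M ∈ stratum σ ϖ T ![2 * ρ, 2 * ρ + s, 2 * ρ + s] ∧
        (LatticeInLevel ϖ (d % 2) (Matrix.diagonal ![α - 1, β - 1, 0]) M ∧ ¬ LatticeInLevel ϖ (d % 2 + 1) (Matrix.diagonal ![α - 1, β - 1, 0]) M ∧
          LatticeInLevel ϖ (mcOfRecord d) (Matrix.diagonal ![(α - 1) * (α - 1), (β - 1) * (β - 1), 0]) M)},
      (labelledOddCount σ ϖ 0 i (valueClassLabel σ ϖ (α - 1) (β - 1) (mstarOfRecord d) d) M : ℚ) /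
        ((((unitStabilizer M).map (unitNormMap σ 3)).relIndex (fixedUnitTorus σ 3) : ℕ) : ℚ) = 0 := by
  have hempty : {M : Submodule 𝒪[K] (Fin 3 → K) | M ∈ stratum σ ϖ T ![2 * ρ, 2 * ρ + s, 2 * ρ + s] ∧
        (LatticeInLevel ϖ (d % 2) (Matrix.diagonal ![α - 1, β - 1, 0]) M ∧ ¬ LatticeInLevel ϖ (d % 2 + 1) (Matrix.diagonal ![α - 1, β - 1, 0]) M ∧
          LatticeInLevel ϖ (mcOfRecord d) (Matrix.diagonal ![(α - 1) * (α - 1), (β - 1) * (β - 1), 0]) M)} = ∅ :=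
    Set.eq_empty_of_forall_notMem fun M hM => not_shell_of_mem_stratum_G1_offFoot hD h2d hE hmc T hT ρ s hρ hs hfoot hread hκ M hM.1 hM.2
  rw [hempty, finsum_mem_empty]

/-- **OFF THE FOOT, IN THE GLUE REGION `min n₂ n₃ < 2ρ + ℓ₀`, NO MEMBER OF `G₁` IS ON THE CLEAN SHELL** (token-free; the tube read may hold or not): off the foot
stability gives `2ρ ≤ n₂` and, with the isosceles read, `2ρ + s ≤ n₁ ≤ n₃` whenever `n₃ < n₂`; so either `n₂ = 2ρ < 2ρ + ℓ₀` and the level-`ℓ₀` token fails (`ℓ₀ + 2ρ ≤ n₂` is one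
of its conjuncts), or the stratum is empty.  This is F0P3a-p01 (g37)'s cell C2b ∪ (C5 off the foot) of the `hRest` coverage ledger. [cite: Kottwitz1986BaseChangeUnits, §1 pp. 240–241]
[cite: Rogawski1990, §4.9 Prop. 4.9.1 (a) p. 55] -/
theorem not_shell_of_mem_stratum_G1_offFoot_glue (hD : IsRamifiedQuadraticDatum σ ϖ d t)
    (hE : IsElementDatum σ ϖ N₀ α β n₁ n₂ n₃)
    (T : GL (Fin 3) K) (hT : (T : Matrix (Fin 3) (Fin 3) K) = Matrix.diagonal ![α, β, 1]) (ρ s : ℕ) (hρ : 1 ≤ ρ) (hs : 1 ≤ s)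
    (hfoot : n₁ ≠ n₂ + s) (hglue : min n₂ n₃ < 2 * ρ + d % 2) :
    ∀ M ∈ stratum σ ϖ T ![2 * ρ, 2 * ρ + s, 2 * ρ + s],
      ¬ (LatticeInLevel ϖ (d % 2) (Matrix.diagonal ![α - 1, β - 1, 0]) M ∧ ¬ LatticeInLevel ϖ (d % 2 + 1) (Matrix.diagonal ![α - 1, β - 1, 0]) M ∧
          LatticeInLevel ϖ (mcOfRecord d) (Matrix.diagonal ![(α - 1) * (α - 1), (β - 1) * (β - 1), 0]) M) := by
  classical
  have hD' := hD
  obtain ⟨hσ, hvσ, hϖ, hfix, -, -, -⟩ := hD'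
  have hϖ0 : ϖ ≠ 0 := fun h0 => by rw [h0, map_zero] at hϖ; exact WithZero.coe_ne_zero hϖ.symm
  have hϖlt : Valued.v ϖ < 1 := by rw [hϖ, ← WithZero.exp_zero, WithZero.exp_lt_exp]; norm_num
  have hα : Valued.v (α - 1) = Valued.v ϖ ^ n₂ := hE.2.2.2.2.2.2.1
  have hβ : Valued.v (β - 1) = Valued.v ϖ ^ n₁ := hE.2.2.2.2.2.1
  have hγ : Valued.v (α - β) = Valued.v ϖ ^ n₃ := hE.2.2.2.2.2.2.2.1
  have hγ' : Valued.v (β - 1 - (α - 1)) = Valued.v ϖ ^ n₃ := by rw [show β - 1 - (α - 1) = -(α - β) by ring, Valuation.map_neg, hγ]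
  have hpw : ∀ a b : ℕ, Valued.v ϖ ^ a ≤ Valued.v ϖ ^ b ↔ b ≤ a := fun a b => by
    rw [v_varpi_pow hϖ, v_varpi_pow hϖ, WithZero.exp_le_exp]; omega
  have hv0 : ∀ ℓ : ℕ, Valued.v (0 : K) ≤ Valued.v ϖ ^ ℓ := fun ℓ => by rw [map_zero]; exact zero_le
  have hsv := v_diag_eq_one hvσ hE
  have hαv : Valued.v α = 1 := by simpa using hsv 0
  have hβv : Valued.v β = 1 := by simpa using hsv 1
  -- isosceles: `min n₁ n₂ ≤ n₃`
  have hn₃min : min n₁ n₂ ≤ n₃ := by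
    have h := Valuation.map_sub Valued.v (β - 1) (α - 1)
    rw [hγ', hβ, hα, le_max_iff, hpw, hpw] at h
    omega
  intro M hM
  rw [stratum_G1_eq hvσ hfix hϖ T hρ hs] at hM
  obtain ⟨x, ζ, y'', hx, hζ, hy, rfl, hTM, -⟩ := hM
  have hdet : (!![1, 0, 0; x, ϖ ^ ρ, 0; x * ζ + y'', ϖ ^ ρ * ζ, ϖ ^ (2 * ρ + s)] : Matrix (Fin 3) (Fin 3) K).det ≠ 0 := by
    rw [Matrix.det_fin_three]; simp [hϖ0]
  -- stability depths off the foot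
  obtain ⟨h1, h2⟩ := depths_of_mapGL_latt_hnf_glued_eq hϖ0 hϖlt hαv hβv T hT hβ hα ρ s hfoot hx hζ hy
    (Matrix.GeneralLinearGroup.mkOfDetNeZero _ hdet) rfl hTM
  have hne : Valued.v ((![α - 1, β - 1, 0] : Fin 3 → K) 2 - (![α - 1, β - 1, 0] : Fin 3 → K) 1) ≠
      Valued.v ((![α - 1, β - 1, 0] : Fin 3 → K) 2 - (![α - 1, β - 1, 0] : Fin 3 → K) 0) * Valued.v ϖ ^ s := by
    simp only [Matrix.cons_val_zero, Matrix.cons_val_one, Matrix.cons_val_two, Matrix.tail_cons, Matrix.head_cons, zero_sub, Valuation.map_neg, hα, hβ, ← pow_add]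
    rw [v_varpi_pow hϖ, v_varpi_pow hϖ, Ne, WithZero.exp_inj]; omega
  have r2 := v_le_pow_iff_of_eq hD hβ
  have r3 := v_le_pow_iff_of_eq hD hγ'
  rw [latticeInLevel_diagonal_latt_G1_iff_of_ne hϖ0 (d % 2) ρ s _ hx hζ hy hne]
  simp only [Matrix.cons_val_zero, Matrix.cons_val_one, Matrix.cons_val_two, Matrix.tail_cons, Matrix.head_cons, zero_sub, Valuation.map_neg, hv0, and_true, r2, r3, hα, ← pow_add, hpw]
  rintro ⟨⟨⟨hl1, hl2⟩, hl3, hl4, hl5, hl6⟩, -, -⟩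
  omega

/-- **R7, OFF THE FOOT, GLUE REGION: `G₁` WITH `min n₂ n₃ < 2ρ + ℓ₀` CARRIES LABELLED ODD VALUE `0`** in every slot (empty cut ∕ empty stratum; F0P3a-p01 (g37)'s cells C2b and
C5-off-the-foot in one head).  Binders ★ p860827 verbatim. [cite: Kottwitz1986BaseChangeUnits, §1 pp. 240–241] [cite: Rogawski1990, §4.9 Prop. 4.9.1 (a)(b) p. 55] -/
theorem finsum_stratum_G1_shell_labelledOdd_div_relIndex_eq_zero_of_offFoot_glue (hD : IsRamifiedQuadraticDatum σ ϖ d t)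
    (hE : IsElementDatum σ ϖ N₀ α β n₁ n₂ n₃)
    (T : GL (Fin 3) K) (hT : (T : Matrix (Fin 3) (Fin 3) K) = Matrix.diagonal ![α, β, 1]) (ρ s : ℕ) (hρ : 1 ≤ ρ) (hs : 1 ≤ s)
    (hfoot : n₁ ≠ n₂ + s) (hglue : min n₂ n₃ < 2 * ρ + d % 2) (i : Fin 3) :
    ∑ᶠ M ∈ {M : Submodule 𝒪[K] (Fin 3 → K) | M ∈ stratum σ ϖ T ![2 * ρ, 2 * ρ + s, 2 * ρ + s] ∧
        (LatticeInLevel ϖ (d % 2) (Matrix.diagonal ![α - 1, β - 1, 0]) M ∧ ¬ LatticeInLevel ϖ (d % 2 + 1) (Matrix.diagonal ![α - 1, β - 1, 0]) M ∧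
          LatticeInLevel ϖ (mcOfRecord d) (Matrix.diagonal ![(α - 1) * (α - 1), (β - 1) * (β - 1), 0]) M)},
      (labelledOddCount σ ϖ 0 i (valueClassLabel σ ϖ (α - 1) (β - 1) (mstarOfRecord d) d) M : ℚ) /
        ((((unitStabilizer M).map (unitNormMap σ 3)).relIndex (fixedUnitTorus σ 3) : ℕ) : ℚ) = 0 := by
  have hempty : {M : Submodule 𝒪[K] (Fin 3 → K) | M ∈ stratum σ ϖ T ![2 * ρ, 2 * ρ + s, 2 * ρ + s] ∧
        (LatticeInLevel ϖ (d % 2) (Matrix.diagonal ![α - 1, β - 1, 0]) M ∧ ¬ LatticeInLevel ϖ (d % 2 + 1) (Matrix.diagonal ![α - 1, β - 1, 0]) M ∧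
          LatticeInLevel ϖ (mcOfRecord d) (Matrix.diagonal ![(α - 1) * (α - 1), (β - 1) * (β - 1), 0]) M)} = ∅ :=
    Set.eq_empty_of_forall_notMem fun M hM => not_shell_of_mem_stratum_G1_offFoot_glue hD hE T hT ρ s hρ hs hfoot hglue M hM.1 hM.2
  rw [hempty, finsum_mem_empty]

/-! ## §2  On the glue foot `n₁ = n₂ + s`: the tube range sits inside level `ℓ₀ + 1`, the top classes fail the square token -/

/-- **ON THE FOOT, TUBE RANGE `2ρ + ℓ₀ + 2 ≤ n₂`: EVERY MEMBER OF `G₁` SITS INSIDE LEVEL `ℓ₀ + 1`** (both terms of the mixed inequality have valuation `n₁ = n₂ + s`), hence is NOT on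
the clean shell. [cite: Kottwitz1986BaseChangeUnits, §1 pp. 240–241] [cite: Serre1980Trees, Ch. II §1.1] -/
theorem not_shell_of_mem_stratum_G1_foot_tube (hD : IsRamifiedQuadraticDatum σ ϖ d t)
    (hE : IsElementDatum σ ϖ N₀ α β n₁ n₂ n₃)
    (T : GL (Fin 3) K) (ρ s : ℕ) (hρ : 1 ≤ ρ) (hs : 1 ≤ s)
    (hfoot : n₁ = n₂ + s) (htube : 2 * ρ + d % 2 + 2 ≤ n₂) :
    ∀ M ∈ stratum σ ϖ T ![2 * ρ, 2 * ρ + s, 2 * ρ + s],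
      ¬ (LatticeInLevel ϖ (d % 2) (Matrix.diagonal ![α - 1, β - 1, 0]) M ∧ ¬ LatticeInLevel ϖ (d % 2 + 1) (Matrix.diagonal ![α - 1, β - 1, 0]) M ∧
          LatticeInLevel ϖ (mcOfRecord d) (Matrix.diagonal ![(α - 1) * (α - 1), (β - 1) * (β - 1), 0]) M) := by
  classical
  have hD' := hD
  obtain ⟨hσ, hvσ, hϖ, hfix, -, -, -⟩ := hD'
  have hϖ0 : ϖ ≠ 0 := fun h0 => by rw [h0, map_zero] at hϖ; exact WithZero.coe_ne_zero hϖ.symm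
  have hα : Valued.v (α - 1) = Valued.v ϖ ^ n₂ := hE.2.2.2.2.2.2.1
  have hβ : Valued.v (β - 1) = Valued.v ϖ ^ n₁ := hE.2.2.2.2.2.1
  have hγ : Valued.v (α - β) = Valued.v ϖ ^ n₃ := hE.2.2.2.2.2.2.2.1
  have hn₁ : N₀ ≤ n₁ := hE.2.2.2.2.2.2.2.2.1
  have hn₂ : N₀ ≤ n₂ := hE.2.2.2.2.2.2.2.2.2.1
  have hn₃ : N₀ ≤ n₃ := hE.2.2.2.2.2.2.2.2.2.2
  have hγ' : Valued.v (β - 1 - (α - 1)) = Valued.v ϖ ^ n₃ := by rw [show β - 1 - (α - 1) = -(α - β) by ring, Valuation.map_neg, hγ]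
  have hpw : ∀ a b : ℕ, Valued.v ϖ ^ a ≤ Valued.v ϖ ^ b ↔ b ≤ a := fun a b => by
    rw [v_varpi_pow hϖ, v_varpi_pow hϖ, WithZero.exp_le_exp]; omega
  -- isosceles: `min n₁ n₂ ≤ n₃`
  have hn₃min : min n₁ n₂ ≤ n₃ := by
    have h := Valuation.map_sub Valued.v (β - 1) (α - 1)
    rw [hγ', hβ, hα, le_max_iff, hpw, hpw] at h
    omega
  intro M hM
  rw [stratum_G1_eq hvσ hfix hϖ T hρ hs] at hM
  obtain ⟨x, ζ, y'', hx, hζ, hy, rfl, -, -⟩ := hM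
  have hgen := fun (ℓ : ℕ) (e : Fin 3 → K) => latticeInLevel_diagonal_latt_G1_iff hϖ0 ℓ ρ s e hx hζ y''
  have htok : LatticeInLevel ϖ (d % 2 + 1) (Matrix.diagonal ![α - 1, β - 1, 0])
      (latt (!![1, 0, 0; x, ϖ ^ ρ, 0; x * ζ + y'', ϖ ^ ρ * ζ, ϖ ^ (2 * ρ + s)] : Matrix (Fin 3) (Fin 3) K)) := by
    rw [hgen]
    simp only [Matrix.cons_val_zero, Matrix.cons_val_one, Matrix.cons_val_two, Matrix.tail_cons, Matrix.head_cons, zero_sub, mul_neg, neg_mul, Valuation.map_neg, map_zero, zero_le, and_true]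
    refine ⟨⟨?_, ?_⟩, ?_, ?_, ?_⟩
    · rw [hα, hpw]; omega
    · rw [hβ, hpw]; omega
    · rw [hγ', hpw]; omega
    · rw [hβ, hpw]; omega
    · refine (Valuation.map_add _ _ _).trans (max_le ?_ ?_)
      · rw [Valuation.map_neg, map_mul, map_mul, hx, hζ, one_mul, one_mul, hβ, hpw]; omega
      · rw [Valuation.map_neg, map_mul, hα, hy, ← pow_add, hpw]; omega
  rintro ⟨-, h, -⟩
  exact h htok

/-- **ON THE FOOT, TOP CLASSES `2·n₂ < 2ρ + mc`: EVERY MEMBER OF `G₁` FAILS THE SQUARE TOKEN AT `mc = mcOfRecord d`** (the mixed term of the ★ read at `((α−1)², (β−1)², 0)` has the two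
valuations `2n₁ = 2n₂ + 2s` and `2n₂ + s`, distinct, so the token needs `2ρ + mc ≤ 2n₂`), hence is NOT on the clean shell.  Token-free; covers `ρ + ℓ₀ > n₂` and the unstable range too.
[cite: Kottwitz1986BaseChangeUnits, §1 pp. 240–241] [cite: Serre1980Trees, Ch. II §1.1] -/
theorem not_shell_of_mem_stratum_G1_foot_top (hD : IsRamifiedQuadraticDatum σ ϖ d t)
    (hE : IsElementDatum σ ϖ N₀ α β n₁ n₂ n₃)
    (T : GL (Fin 3) K) (ρ s : ℕ) (hρ : 1 ≤ ρ) (hs : 1 ≤ s)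
    (hfoot : n₁ = n₂ + s) (htop : 2 * n₂ < 2 * ρ + mcOfRecord d) :
    ∀ M ∈ stratum σ ϖ T ![2 * ρ, 2 * ρ + s, 2 * ρ + s],
      ¬ (LatticeInLevel ϖ (d % 2) (Matrix.diagonal ![α - 1, β - 1, 0]) M ∧ ¬ LatticeInLevel ϖ (d % 2 + 1) (Matrix.diagonal ![α - 1, β - 1, 0]) M ∧
          LatticeInLevel ϖ (mcOfRecord d) (Matrix.diagonal ![(α - 1) * (α - 1), (β - 1) * (β - 1), 0]) M) := by
  classical
  have hD' := hD
  obtain ⟨hσ, hvσ, hϖ, hfix, -, -, -⟩ := hD'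
  have hϖ0 : ϖ ≠ 0 := fun h0 => by rw [h0, map_zero] at hϖ; exact WithZero.coe_ne_zero hϖ.symm
  have hα : Valued.v (α - 1) = Valued.v ϖ ^ n₂ := hE.2.2.2.2.2.2.1
  have hβ : Valued.v (β - 1) = Valued.v ϖ ^ n₁ := hE.2.2.2.2.2.1
  have hpw : ∀ a b : ℕ, Valued.v ϖ ^ a ≤ Valued.v ϖ ^ b ↔ b ≤ a := fun a b => by
    rw [v_varpi_pow hϖ, v_varpi_pow hϖ, WithZero.exp_le_exp]; omega
  have hA2 : Valued.v ((α - 1) * (α - 1)) = Valued.v ϖ ^ (2 * n₂) := by rw [map_mul, hα, ← pow_add, two_mul]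
  have hB2 : Valued.v ((β - 1) * (β - 1)) = Valued.v ϖ ^ (2 * n₁) := by rw [map_mul, hβ, ← pow_add, two_mul]
  intro M hM
  rw [stratum_G1_eq hvσ hfix hϖ T hρ hs] at hM
  obtain ⟨x, ζ, y'', hx, hζ, hy, rfl, -, -⟩ := hM
  -- the squares are OFF their cancellation locus: `2n₁ = 2n₂ + 2s ≠ 2n₂ + s`
  have hne : Valued.v ((![(α - 1) * (α - 1), (β - 1) * (β - 1), 0] : Fin 3 → K) 2 - (![(α - 1) * (α - 1), (β - 1) * (β - 1), 0] : Fin 3 → K) 1) ≠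
      Valued.v ((![(α - 1) * (α - 1), (β - 1) * (β - 1), 0] : Fin 3 → K) 2 - (![(α - 1) * (α - 1), (β - 1) * (β - 1), 0] : Fin 3 → K) 0) * Valued.v ϖ ^ s := by
    simp only [Matrix.cons_val_zero, Matrix.cons_val_one, Matrix.cons_val_two, Matrix.tail_cons, Matrix.head_cons, zero_sub, Valuation.map_neg, hA2, hB2, ← pow_add]
    rw [v_varpi_pow hϖ, v_varpi_pow hϖ, Ne, WithZero.exp_inj]; omega
  rw [latticeInLevel_diagonal_latt_G1_iff_of_ne hϖ0 (mcOfRecord d) ρ s _ hx hζ hy hne]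
  simp only [Matrix.cons_val_zero, Matrix.cons_val_one, Matrix.cons_val_two, Matrix.tail_cons, Matrix.head_cons, zero_sub, Valuation.map_neg, hA2, ← pow_add, hpw]
  rintro ⟨-, -, -, -, -, -, h⟩
  omega

/-- **R7, ON THE FOOT, TUBE RANGE: `G₁` CARRIES LABELLED ODD VALUE `0`** (`n₁ = n₂ + s`, `2ρ + ℓ₀ + 2 ≤ n₂`; empty cut — the tube read `2ρ + s + ℓ₀ = n₁` is false on the foot,
so these strata ARE rest shapes of (T1) v1).  Binders ★ p860827 verbatim. [cite: Kottwitz1986BaseChangeUnits, §1 pp. 240–241] [cite: Rogawski1990, §4.9 Prop. 4.9.1 (a)(b) p. 55] -/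
theorem finsum_stratum_G1_shell_labelledOdd_div_relIndex_eq_zero_of_foot_tube (hD : IsRamifiedQuadraticDatum σ ϖ d t)
    (hE : IsElementDatum σ ϖ N₀ α β n₁ n₂ n₃)
    (T : GL (Fin 3) K) (ρ s : ℕ) (hρ : 1 ≤ ρ) (hs : 1 ≤ s)
    (hfoot : n₁ = n₂ + s) (htube : 2 * ρ + d % 2 + 2 ≤ n₂) (i : Fin 3) :
    ∑ᶠ M ∈ {M : Submodule 𝒪[K] (Fin 3 → K) | M ∈ stratum σ ϖ T ![2 * ρ, 2 * ρ + s, 2 * ρ + s] ∧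
        (LatticeInLevel ϖ (d % 2) (Matrix.diagonal ![α - 1, β - 1, 0]) M ∧ ¬ LatticeInLevel ϖ (d % 2 + 1) (Matrix.diagonal ![α - 1, β - 1, 0]) M ∧
          LatticeInLevel ϖ (mcOfRecord d) (Matrix.diagonal ![(α - 1) * (α - 1), (β - 1) * (β - 1), 0]) M)},
      (labelledOddCount σ ϖ 0 i (valueClassLabel σ ϖ (α - 1) (β - 1) (mstarOfRecord d) d) M : ℚ) /
        ((((unitStabilizer M).map (unitNormMap σ 3)).relIndex (fixedUnitTorus σ 3) : ℕ) : ℚ) = 0 := by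
  have hempty : {M : Submodule 𝒪[K] (Fin 3 → K) | M ∈ stratum σ ϖ T ![2 * ρ, 2 * ρ + s, 2 * ρ + s] ∧
        (LatticeInLevel ϖ (d % 2) (Matrix.diagonal ![α - 1, β - 1, 0]) M ∧ ¬ LatticeInLevel ϖ (d % 2 + 1) (Matrix.diagonal ![α - 1, β - 1, 0]) M ∧
          LatticeInLevel ϖ (mcOfRecord d) (Matrix.diagonal ![(α - 1) * (α - 1), (β - 1) * (β - 1), 0]) M)} = ∅ :=
    Set.eq_empty_of_forall_notMem fun M hM => not_shell_of_mem_stratum_G1_foot_tube hD hE T ρ s hρ hs hfoot htube M hM.1 hM.2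
  rw [hempty, finsum_mem_empty]

/-- **R7, ON THE FOOT, TOP CLASSES: `G₁` CARRIES LABELLED ODD VALUE `0`** (`n₁ = n₂ + s`, `2·n₂ < 2ρ + mcOfRecord d`; empty cut — the square token fails).  Binders ★ p860827
verbatim. [cite: Kottwitz1986BaseChangeUnits, §1 pp. 240–241] [cite: Rogawski1990, §4.9 Prop. 4.9.1 (a)(b) p. 55] -/
theorem finsum_stratum_G1_shell_labelledOdd_div_relIndex_eq_zero_of_foot_top (hD : IsRamifiedQuadraticDatum σ ϖ d t)
    (hE : IsElementDatum σ ϖ N₀ α β n₁ n₂ n₃)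
    (T : GL (Fin 3) K) (ρ s : ℕ) (hρ : 1 ≤ ρ) (hs : 1 ≤ s)
    (hfoot : n₁ = n₂ + s) (htop : 2 * n₂ < 2 * ρ + mcOfRecord d) (i : Fin 3) :
    ∑ᶠ M ∈ {M : Submodule 𝒪[K] (Fin 3 → K) | M ∈ stratum σ ϖ T ![2 * ρ, 2 * ρ + s, 2 * ρ + s] ∧
        (LatticeInLevel ϖ (d % 2) (Matrix.diagonal ![α - 1, β - 1, 0]) M ∧ ¬ LatticeInLevel ϖ (d % 2 + 1) (Matrix.diagonal ![α - 1, β - 1, 0]) M ∧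
          LatticeInLevel ϖ (mcOfRecord d) (Matrix.diagonal ![(α - 1) * (α - 1), (β - 1) * (β - 1), 0]) M)},
      (labelledOddCount σ ϖ 0 i (valueClassLabel σ ϖ (α - 1) (β - 1) (mstarOfRecord d) d) M : ℚ) /
        ((((unitStabilizer M).map (unitNormMap σ 3)).relIndex (fixedUnitTorus σ 3) : ℕ) : ℚ) = 0 := by
  have hempty : {M : Submodule 𝒪[K] (Fin 3 → K) | M ∈ stratum σ ϖ T ![2 * ρ, 2 * ρ + s, 2 * ρ + s] ∧
        (LatticeInLevel ϖ (d % 2) (Matrix.diagonal ![α - 1, β - 1, 0]) M ∧ ¬ LatticeInLevel ϖ (d % 2 + 1) (Matrix.diagonal ![α - 1, β - 1, 0]) M ∧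
          LatticeInLevel ϖ (mcOfRecord d) (Matrix.diagonal ![(α - 1) * (α - 1), (β - 1) * (β - 1), 0]) M)} = ∅ :=
    Set.eq_empty_of_forall_notMem fun M hM => not_shell_of_mem_stratum_G1_foot_top hD hE T ρ s hρ hs hfoot htop M hM.1 hM.2
  rw [hempty, finsum_mem_empty]

end Summit.HodgeConjecture.HodgeConjecture.Cruxes.H413.F0P3cDyRamLabelledOddGlueClasses

end
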